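import Summits.CriticalPhenomena.PercolationContinuityZ3.Theorems.PercNearOneGluingNoHeavyLowerTailFrontierDecRowsRow44CutVertex
import Mathlib.Tactic.Linarith
import HarnessLib

/-!
# Row 36 across a cut vertex isolating a leaf (route `PercNearOneGluingNoHeavy`, supports-only; prim-l12-p6 g15)

Frontier dec row 36 is `E₃(D[a|b], D[a|c], D[b|y]) ≥ 0` (the path `c – a – b – y`).  Here a cut vertex `h` separates the leaf `c` (colour `false`) from `a, b, y`
(colour `true`); the hub case is `…Row36ThreeOneCutA`.

THEOREM (`sahiE3_row36_nonneg_of_threeOneCut_c`).  If every positive-weight edge avoiding `h` is monochromatic for such a colouring and row 36 is non-negative at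
`(a,b,h,y)`, then row 36 is non-negative at `(a,b,c,y)`.
PROOF.  Only `D[a|c] = ({a ↔ h} ∧ {h ↔ c on the far side})ᶜ` depends on the far side, so Sahi's functional is AFFINE in `ρ = P(h ↔ c)`:
**`E₃(row 36 at (a,b,c,y)) = (1−ρ)·Cov(D[a|b], D[b|y]) + ρ·E₃(row 36 at (a,b,h,y))`**, and the covariance of two decreasing events is non-negative (Harris,
`prodBernoulli_harris_lower`).  By the symmetry `(a,b,c,y) ↦ (b,a,y,c)` of row 36 the same covers the leaf `y`.  ∎
Recorded in `run/shared/lean/prim/prim-l12/FROM-prim-l12-p6-g15-ROW44-CUT-VERTICES.md` §8.4.  No definitions, no named facts, no sorries.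
-/

noncomputable section

namespace Summit.CriticalPhenomena.PercolationContinuityZ3.Theorems.FrontierDecRows

open MeasureTheory CovTransferCert E3GroupSepCert
open Literature.Probability.Percolation Literature.Probability.LatticeModels

variable {n : ℕ}

/-- The row-36 leaf pencil in real variables: `r = P(h ↔ c)`, `x = P{a≁b}`, `z = P{b≁y}`, `a = P{a ↔ h}`, joint probabilities `xz, xa, za, xza`. [this work] -/
theorem row36_threeOneCutC_ineq (r x z a xz xa za xza : ℝ) (hr0 : 0 ≤ r) (hr1 : r ≤ 1) (hH : x * z ≤ xz)
    (h36 : 0 ≤ 2 * (xz - xza) + x * (1 - a) * z - (x * (z - za) + (1 - a) * xz + z * (x - xa))) :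
    0 ≤ 2 * (xz - xza * r) + x * (1 - a * r) * z - (x * (z - za * r) + (1 - a * r) * xz + z * (x - xa * r)) := by
  have key : 2 * (xz - xza * r) + x * (1 - a * r) * z - (x * (z - za * r) + (1 - a * r) * xz + z * (x - xa * r)) =
      (1 - r) * (xz - x * z) + r * (2 * (xz - xza) + x * (1 - a) * z - (x * (z - za) + (1 - a) * xz + z * (x - xa))) := by
    ring
  rw [key]
  have t1 := mul_nonneg (sub_nonneg.2 hr1) (sub_nonneg.2 hH)
  have t2 := mul_nonneg hr0 h36
  linarith

set_option maxHeartbeats 1600000 in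
/-- **Row 36 across a cut vertex isolating the leaf `c`.**  `a, b, y` coloured `true`, `c` coloured `false`, every positive-weight edge avoiding `h` monochromatic:
row 36 at `(a,b,h,y)` implies row 36 at `(a,b,c,y)` (linear pencil `(1−ρ)·Cov(D[a|b],D[b|y]) + ρ·row 36 at (a,b,h,y)`, `ρ = P(h ↔ c)`). [this work] -/
theorem sahiE3_row36_nonneg_of_threeOneCut_c (w : Sym2 (Fin n) → unitInterval) (a b c y h : Fin n) (side : Fin n → Bool)
    (ha : side a = true) (hb : side b = true) (hy : side y = true) (hc : side c = false)
    (hw : ∀ u v : Fin n, u ≠ h → v ≠ h → side u ≠ side v → w s(u, v) = 0)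
    (h36 : 0 ≤ sahiE3 (prodBernoulli w) (connEvent (row 36 n (a, b, h, y)).1) (connEvent (row 36 n (a, b, h, y)).2.1)
      (connEvent (row 36 n (a, b, h, y)).2.2)) :
    0 ≤ sahiE3 (prodBernoulli w) (connEvent (row 36 n (a, b, c, y)).1) (connEvent (row 36 n (a, b, c, y)).2.1)
      (connEvent (row 36 n (a, b, c, y)).2.2) := by
  classical
  have hrow : row 36 n (a, b, c, y) = (sep [a] [b], sep [a] [c], sep [b] [y]) := rfl
  have hrow' : row 36 n (a, b, h, y) = (sep [a] [b], sep [a] [h], sep [b] [y]) := rfl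
  simp only [hrow, connEvent_sep]
  simp only [hrow', connEvent_sep] at h36
  set μ := prodBernoulli w with hμ
  have hac : a ≠ c := fun e => by rw [e, hc] at ha; exact Bool.false_ne_true ha
  set F₁ : Finset (Sym2 (Fin n)) := Finset.univ.filter (fun e => ∀ u ∈ e, side u = true ∨ u = h) with hF₁
  set F₂ : Finset (Sym2 (Fin n)) :=
    Finset.univ.filter (fun e => (∀ u ∈ e, side u = false ∨ u = h) ∧ ¬ ∀ u ∈ e, u = h) with hF₂
  have mem₁ : ∀ e, e ∈ F₁ ↔ ∀ u ∈ e, side u = true ∨ u = h := fun e => by rw [hF₁, Finset.mem_filter]; simp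
  have mem₂ : ∀ e, e ∈ F₂ ↔ (∀ u ∈ e, side u = false ∨ u = h) ∧ ¬ ∀ u ∈ e, u = h := fun e => by
    rw [hF₂, Finset.mem_filter]; simp
  have hdisj : Disjoint F₁ F₂ := by
    rw [Finset.disjoint_left]; intro e h1 h2; rw [mem₁] at h1; rw [mem₂] at h2
    apply h2.2
    intro u hu
    rcases h1 u hu with h1 | h1
    · rcases h2.1 u hu with h2 | h2
      · rw [h1] at h2; exact absurd h2 (by decide)
      · exact h2
    · exact h1
  set D : Finset (Sym2 (Fin n)) := F₁ ∪ F₂ with hD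
  have hwD : ∀ e, e ∉ D → w e = 0 := by
    intro e he
    rw [hD, Finset.mem_union, not_or, mem₁, mem₂] at he
    obtain ⟨h1, h2⟩ := he
    induction e using Sym2.ind with
    | h u v =>
      have key : u ≠ h ∧ v ≠ h ∧ side u ≠ side v := by
        by_cases hu : u = h
        · subst hu
          exfalso
          by_cases hv : v = u
          · exact h1 fun x hx => Or.inr (by rcases Sym2.mem_iff.1 hx with e | e <;> [exact e; exact e.trans hv])
          · cases hsv : side v
            · exact h2 ⟨fun x hx => by rcases Sym2.mem_iff.1 hx with e | e <;> [exact Or.inr e; exact Or.inl (e ▸ hsv)],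
                fun hall => hv (hall v (Sym2.mem_iff.2 (Or.inr rfl)))⟩
            · exact h1 fun x hx => by rcases Sym2.mem_iff.1 hx with e | e <;> [exact Or.inr e; exact Or.inl (e ▸ hsv)]
        · by_cases hv : v = h
          · subst hv
            exfalso
            cases hsu : side u
            · exact h2 ⟨fun x hx => by rcases Sym2.mem_iff.1 hx with e | e <;> [exact Or.inl (e ▸ hsu); exact Or.inr e],
                fun hall => hu (hall u (Sym2.mem_iff.2 (Or.inl rfl)))⟩
            · exact h1 fun x hx => by rcases Sym2.mem_iff.1 hx with e | e <;> [exact Or.inl (e ▸ hsu); exact Or.inr e]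
          · refine ⟨hu, hv, fun hse => ?_⟩
            cases hsu : side u
            · exact h2 ⟨fun x hx => by
                  rcases Sym2.mem_iff.1 hx with e | e <;> [exact Or.inl (e ▸ hsu); exact Or.inl (e ▸ (hse ▸ hsu))],
                fun hall => hu (hall u (Sym2.mem_iff.2 (Or.inl rfl)))⟩
            · exact h1 fun x hx => by
                rcases Sym2.mem_iff.1 hx with e | e <;> [exact Or.inl (e ▸ hsu); exact Or.inl (e ▸ (hse ▸ hsu))]
      exact hw u v key.1 key.2.1 key.2.2
  have hT : ∀ ω : Set (Sym2 (Fin n)), ∀ v u u', (openGraph (ω ∩ ↑F₁)).Adj v u → (openGraph (ω ∩ ↑F₂)).Adj v u' → v = h := by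
    intro ω v u u' h1 h2
    rw [openGraph_adj] at h1 h2
    have e1 := (mem₁ _).1 (Finset.mem_coe.1 h1.1.2) v (Sym2.mem_iff.2 (Or.inl rfl))
    have e2 := ((mem₂ _).1 (Finset.mem_coe.1 h2.1.2)).1 v (Sym2.mem_iff.2 (Or.inl rfl))
    rcases e1 with e1 | e1
    · rcases e2 with e2 | e2
      · rw [e1] at e2; exact absurd e2 (by decide)
      · exact e2
    · exact e1
  have iso₂ : ∀ ω : Set (Sym2 (Fin n)), ∀ x, side x = true → x ≠ h → ∀ u, ¬ (openGraph (ω ∩ ↑F₂)).Adj x u := by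
    intro ω x hx hxh u hadj
    rw [openGraph_adj] at hadj
    rcases ((mem₂ _).1 (Finset.mem_coe.1 hadj.1.2)).1 x (Sym2.mem_iff.2 (Or.inl rfl)) with e | e
    · rw [hx] at e; exact Bool.noConfusion e
    · exact hxh e
  have iso₁ : ∀ ω : Set (Sym2 (Fin n)), ∀ x, side x = false → x ≠ h → ∀ u, ¬ (openGraph (ω ∩ ↑F₁)).Adj x u := by
    intro ω x hx hxh u hadj
    rw [openGraph_adj] at hadj
    rcases (mem₁ _).1 (Finset.mem_coe.1 hadj.1.2) x (Sym2.mem_iff.2 (Or.inl rfl)) with e | e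
    · rw [hx] at e; exact Bool.noConfusion e
    · exact hxh e
  have isoH : ∀ ω : Set (Sym2 (Fin n)), h ≠ h → ∀ u, ¬ (openGraph (ω ∩ ↑F₂)).Adj h u := fun ω hh => absurd rfl hh
  have hsup : ∀ ω : Set (Sym2 (Fin n)), openGraph (ω ∩ ↑D) = openGraph (ω ∩ ↑F₁) ⊔ openGraph (ω ∩ ↑F₂) := by
    intro ω
    rw [hD, Finset.coe_union, Set.inter_union_distrib_left]
    exact SimpleGraph.fromEdgeSet_union _ _
  have pl : ∀ ω : Set (Sym2 (Fin n)), ∀ x z, side x = true → side z = true →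
      ((openGraph (ω ∩ ↑D)).Reachable x z ↔ (openGraph (ω ∩ ↑F₁)).Reachable x z) := by
    intro ω x z hx hz; rw [hsup ω]; exact reachable_sup_iff_left (hT ω) (iso₂ ω x hx) (iso₂ ω z hz)
  have plh : ∀ ω : Set (Sym2 (Fin n)), ∀ x, side x = true →
      ((openGraph (ω ∩ ↑D)).Reachable x h ↔ (openGraph (ω ∩ ↑F₁)).Reachable x h) := by
    intro ω x hx; rw [hsup ω]; exact reachable_sup_iff_left (hT ω) (iso₂ ω x hx) (isoH ω)
  have pc : ∀ ω : Set (Sym2 (Fin n)), ∀ x, side x = true → x ≠ c →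
      ((openGraph (ω ∩ ↑D)).Reachable x c ↔
        (openGraph (ω ∩ ↑F₁)).Reachable x h ∧ (openGraph (ω ∩ ↑F₂)).Reachable h c) := by
    intro ω x hx hxc
    rw [hsup ω]
    exact reachable_sup_iff_cross (hT ω) (iso₂ ω x hx) (iso₁ ω c hc) hxc
  set Eab : Set (Set (Sym2 (Fin n))) := {ω | ω ∩ ↑F₁ ∈ ((openConn a b)ᶜ : Set (Set (Sym2 (Fin n))))} with hEab
  set Eby : Set (Set (Sym2 (Fin n))) := {ω | ω ∩ ↑F₁ ∈ ((openConn b y)ᶜ : Set (Set (Sym2 (Fin n))))} with hEby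
  set Ha : Set (Set (Sym2 (Fin n))) := {ω | ω ∩ ↑F₁ ∈ (openConn a h : Set (Set (Sym2 (Fin n))))} with hHa
  set EC : Set (Set (Sym2 (Fin n))) := {ω | ω ∩ ↑F₂ ∈ (openConn h c : Set (Set (Sym2 (Fin n))))} with hEC
  set X : Set (Set (Sym2 (Fin n))) := {ω | ∀ x ∈ [a], ∀ z ∈ [b], ω ∉ openConn x z} with hX
  set Y : Set (Set (Sym2 (Fin n))) := {ω | ∀ x ∈ [a], ∀ z ∈ [c], ω ∉ openConn x z} with hY
  set Z : Set (Set (Sym2 (Fin n))) := {ω | ∀ x ∈ [b], ∀ z ∈ [y], ω ∉ openConn x z} with hZ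
  set Yh : Set (Set (Sym2 (Fin n))) := {ω | ∀ x ∈ [a], ∀ z ∈ [h], ω ∉ openConn x z} with hYh
  have tX : {ω : Set (Sym2 (Fin n)) | ω ∩ ↑D ∈ X} = Eab := by
    ext ω
    simp only [hX, hEab, Set.mem_setOf_eq, List.mem_singleton, forall_eq, Set.mem_compl_iff, openConn]
    exact not_congr (pl ω a b ha hb)
  have tY : {ω : Set (Sym2 (Fin n)) | ω ∩ ↑D ∈ Y} = (Ha ∩ EC)ᶜ := by
    ext ω
    simp only [hY, hHa, hEC, Set.mem_setOf_eq, Set.mem_inter_iff, Set.mem_compl_iff, openConn, List.mem_singleton, forall_eq]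
    rw [pc ω a ha hac]
  have tZ : {ω : Set (Sym2 (Fin n)) | ω ∩ ↑D ∈ Z} = Eby := by
    ext ω
    simp only [hZ, hEby, Set.mem_setOf_eq, List.mem_singleton, forall_eq, Set.mem_compl_iff, openConn]
    exact not_congr (pl ω b y hb hy)
  have tYh : {ω : Set (Sym2 (Fin n)) | ω ∩ ↑D ∈ Yh} = Haᶜ := by
    ext ω
    simp only [hYh, hHa, Set.mem_setOf_eq, Set.mem_compl_iff, openConn, List.mem_singleton, forall_eq]
    rw [plh ω a ha]
  have thin : ∀ A : Set (Set (Sym2 (Fin n))), μ.real A = μ.real {ω | ω ∩ ↑D ∈ A} :=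
    fun A => real_eq_real_setOf_inter_mem w D hwD A
  have pre_inter : ∀ P Q : Set (Set (Sym2 (Fin n))),
      {ω : Set (Sym2 (Fin n)) | ω ∩ ↑D ∈ P ∩ Q} = {ω | ω ∩ ↑D ∈ P} ∩ {ω | ω ∩ ↑D ∈ Q} := fun P Q => rfl
  have ms : ∀ A : Set (Set (Sym2 (Fin n))), MeasurableSet A := fun A => (Set.toFinite _).measurableSet
  have detC : DeterminedBy EC (↑F₁ : Set (Sym2 (Fin n)))ᶜ := by
    rw [determinedBy_iff]
    intro ω ω' hω
    have hsub : (↑F₂ : Set (Sym2 (Fin n))) ⊆ (↑F₁ : Set (Sym2 (Fin n)))ᶜ := fun e he he1 =>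
      Finset.disjoint_left.1 hdisj (Finset.mem_coe.1 he1) (Finset.mem_coe.1 he)
    have : ω ∩ ↑F₂ = ω' ∩ ↑F₂ := by
      rw [← Set.inter_eq_self_of_subset_right hsub, ← Set.inter_assoc, ← Set.inter_assoc, hω]
    simp only [hEC, Set.mem_setOf_eq, this]
  have indep : ∀ S : Set (Set (Sym2 (Fin n))), (∀ ω ω' : Set (Sym2 (Fin n)), ω ∩ ↑F₁ = ω' ∩ ↑F₁ → (ω ∈ S ↔ ω' ∈ S)) →
      μ.real (S ∩ EC) = μ.real S * μ.real EC :=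
    fun S hS => prodBernoulli_real_inter_of_determinedBy w F₁ ((determinedBy_iff S _).2 hS) detC (ms _) (ms _)
  have sd : ∀ S : Set (Set (Sym2 (Fin n))), (∃ P : Set (Set (Sym2 (Fin n))), S = {ω | ω ∩ ↑F₁ ∈ P}) →
      ∀ ω ω' : Set (Sym2 (Fin n)), ω ∩ ↑F₁ = ω' ∩ ↑F₁ → (ω ∈ S ↔ ω' ∈ S) := by
    rintro S ⟨P, rfl⟩ ω ω' hω; simp only [Set.mem_setOf_eq, hω]
  have cpl : ∀ S : Set (Set (Sym2 (Fin n))), μ.real Sᶜ = 1 - μ.real S := by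
    intro S; rw [Set.compl_eq_univ_sdiff, measureReal_sdiff (Set.subset_univ _) (ms _)]; simp [hμ]
  have mC : ∀ S H : Set (Set (Sym2 (Fin n))), μ.real (S ∩ Hᶜ) = μ.real S - μ.real (S ∩ H) := by
    intro S H
    have e : S ∩ Hᶜ = S \ (S ∩ H) := by ext ω; simp only [Set.mem_inter_iff, Set.mem_compl_iff, Set.mem_sdiff]; tauto
    rw [e, measureReal_sdiff Set.inter_subset_left (ms _)]
  have eX : μ.real X = μ.real Eab := by rw [thin, tX]
  have eY : μ.real Y = 1 - μ.real Ha * μ.real EC := by rw [thin, tY, cpl, indep Ha (sd _ ⟨openConn a h, rfl⟩)]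
  have eZ : μ.real Z = μ.real Eby := by rw [thin, tZ]
  have eXY : μ.real (X ∩ Y) = μ.real Eab - μ.real (Eab ∩ Ha) * μ.real EC := by
    rw [thin, pre_inter, tX, tY]
    have e : Eab ∩ (Ha ∩ EC)ᶜ = Eab \ ((Eab ∩ Ha) ∩ EC) := by
      ext ω; simp only [Set.mem_inter_iff, Set.mem_compl_iff, Set.mem_sdiff]; tauto
    rw [e, measureReal_sdiff (fun ω hω => hω.1.1) (ms _), indep (Eab ∩ Ha) (sd _ ⟨(openConn a b)ᶜ ∩ openConn a h, rfl⟩)]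
  have eXZ : μ.real (X ∩ Z) = μ.real (Eab ∩ Eby) := by rw [thin, pre_inter, tX, tZ]
  have eYZ : μ.real (Y ∩ Z) = μ.real Eby - μ.real (Eby ∩ Ha) * μ.real EC := by
    rw [thin, pre_inter, tY, tZ]
    have e : (Ha ∩ EC)ᶜ ∩ Eby = Eby \ ((Eby ∩ Ha) ∩ EC) := by
      ext ω; simp only [Set.mem_inter_iff, Set.mem_compl_iff, Set.mem_sdiff]; tauto
    rw [e, measureReal_sdiff (fun ω hω => hω.1.1) (ms _), indep (Eby ∩ Ha) (sd _ ⟨(openConn b y)ᶜ ∩ openConn a h, rfl⟩)]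
  have eXYZ : μ.real (X ∩ Y ∩ Z) = μ.real (Eab ∩ Eby) - μ.real (Eab ∩ Eby ∩ Ha) * μ.real EC := by
    rw [thin, pre_inter, pre_inter, tX, tY, tZ]
    have e : Eab ∩ (Ha ∩ EC)ᶜ ∩ Eby = (Eab ∩ Eby) \ ((Eab ∩ Eby ∩ Ha) ∩ EC) := by
      ext ω; simp only [Set.mem_inter_iff, Set.mem_compl_iff, Set.mem_sdiff]; tauto
    rw [e, measureReal_sdiff (fun ω hω => hω.1.1) (ms _),
      indep (Eab ∩ Eby ∩ Ha) (sd _ ⟨(openConn a b)ᶜ ∩ (openConn b y)ᶜ ∩ openConn a h, rfl⟩)]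
  have i1 : μ.real (X ∩ Yh ∩ Z) = μ.real (Eab ∩ Eby) - μ.real (Eab ∩ Eby ∩ Ha) := by
    rw [thin, pre_inter, pre_inter, tX, tYh, tZ]
    have e : Eab ∩ Haᶜ ∩ Eby = (Eab ∩ Eby) ∩ Haᶜ := by
      ext ω; simp only [Set.mem_inter_iff, Set.mem_compl_iff]; tauto
    rw [e, mC]
  have i2 : μ.real Yh = 1 - μ.real Ha := by rw [thin, tYh, cpl]
  have i3 : μ.real (Yh ∩ Z) = μ.real Eby - μ.real (Eby ∩ Ha) := by rw [thin, pre_inter, tYh, tZ, Set.inter_comm, mC]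
  have i4 : μ.real (X ∩ Yh) = μ.real Eab - μ.real (Eab ∩ Ha) := by rw [thin, pre_inter, tX, tYh, mC]
  rw [sahiE3_def, i1, i3, i4, i2, eX, eZ, eXZ] at h36
  have loConn : ∀ u v : Fin n,
      IsLowerSet {ω : Set (Sym2 (Fin n)) | ω ∩ ↑F₁ ∈ ((openConn u v)ᶜ : Set (Set (Sym2 (Fin n))))} := by
    intro u v ω ω' hle hω
    simp only [Set.mem_setOf_eq, Set.mem_compl_iff] at hω ⊢
    exact fun h' => hω (isUpperSet_openConn u v (Set.inter_subset_inter_left _ hle) h')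
  have hH : μ.real Eab * μ.real Eby ≤ μ.real (Eab ∩ Eby) := prodBernoulli_harris_lower w (loConn a b) (loConn b y) (ms _) (ms _)
  have hρ0 : 0 ≤ μ.real EC := measureReal_nonneg
  have hρ1 : μ.real EC ≤ 1 := (measureReal_mono (Set.subset_univ EC)).trans (le_of_eq (by simp [hμ]))
  rw [sahiE3_def, eXYZ, eXY, eXZ, eYZ, eX, eY, eZ]
  exact row36_threeOneCutC_ineq _ _ _ _ _ _ _ _ hρ0 hρ1 hH h36

end Summit.CriticalPhenomena.PercolationContinuityZ3.Theorems.FrontierDecRows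

end
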